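import Summits.AtomisticToContinuum.HydrodynamicLimit.Theorems.AntiMazurCoboundariesCorrectorPressureDecayKiferCanonicalLocalLimitClosure
import Literature.MathematicalPhysics.KineticTheory.HardSphereUniformGas
import Literature.MathematicalPhysics.KineticTheory.HardSphereMeanCollisionCount
import Literature.MathematicalPhysics.KineticTheory.HardSphereCanonicalClusterBound

/-!
# The canonical local limit, VI: the canonical law is dominated by the ideal gas on local events (line `FirstLemma`, crux stmt-AtomisticToContinuum-14135)

Helper file (Core) of the registered stub `stub_canonicalBlowUpWindowDomination` (E1-ii, uniform window domination) of
skeleton v10 of line `FirstLemma`, namespace `Summit.AtomisticToContinuum.HydrodynamicLimit.Theorems.KiferCompactification`.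
The two finite-`N` inequalities behind the domination of the window laws of the x-averaged blown-up canonical laws:

* `rN_uniform_le_of_le_half` — the ITERATED INSERTION BOUND at every reduced density `0 < σ ≤ 1/2`:
  `Ξ_N(N+1-m)/Ξ_N(N+1) ≤ (1 - v₁σ³)^{-m}` (`v₁ = 4π/3`, `v₁σ³ ≤ 11/20`; one insertion costs at most the excluded
  volume `N · v₁ ε_N³ ≤ v₁σ³`; for `N = 0` all hard-core probabilities are `1`);
* `localGibbsLaw_le_of_dependsOn` — RUELLE'S BOUND IN EVENT FORM: an event of `(N+1)`-particle phase space that only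
  involves the labels of `S` has canonical (constant-profile local Gibbs) probability at most `(1 - v₁σ³)^{-#S}` times
  its probability under the IDEAL GAS `(Haar ⊗ Maxwellian)^{⊗(N+1)}` (positions and velocities are independent under
  the canonical law, `localGibbsMeasure_rung0_eq_map`; drop the hard-core constraints involving `S`,
  `pi_hardCore_inter_le_of_dependsOn`; bound the ratio of partition functions by the insertion bound);
* `pi_le_pow_smul_pi` — `κ ≤ c • ν` implies `κ^{⊗m} ≤ cᵐ • ν^{⊗m}`;
* `map_blowUpPoint_le` — the blow-up of ONE ideal-gas particle around any base point has law `≤ ε³ · (Leb ⊗ Maxwellian)`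
  (Haar measure is translation invariant, `reprSym` pushes it to Lebesgue measure on the symmetric cube, `y ↦ ε⁻¹ y`
  scales Lebesgue measure by `ε³`);
* `localGibbsLaw_blowUpLabels_le` — hence the joint law of the blow-ups of `m` DISTINCT labelled particles under the
  canonical law is at most `((1 - v₁σ³)⁻¹ ε_N³)ᵐ · (Leb ⊗ Maxwellian)^{⊗m}` (independence of distinct labels under the
  ideal gas, `iIndepFun_pi`).

References: D. Ruelle, *Statistical Mechanics: Rigorous Results* (1969) §4.2 (bounds on canonical correlation
functions by insertion ratios); H.-O. Georgii, J. Stat. Phys. 80 (1995) §3.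
-/

noncomputable section

open MeasureTheory Set Filter Topology Function
open scoped ENNReal NNReal

namespace Summit.AtomisticToContinuum.HydrodynamicLimit.Theorems.KiferCompactification

open Literature.MathematicalPhysics.KineticTheory
open Literature.MathematicalPhysics.StatisticalMechanics (hcProb hardCoreSet hcProb_nonneg)
open Literature.Analysis.FluidPDE (HardSphereFlow Config)
open Literature.Analysis.FluidPDE.Torus (reprSym symCube measurable_reprSym map_reprSym_volume)

/-! ## The iterated insertion bound at every reduced density `σ ≤ 1/2` -/

/-- **Iterated insertion bound below half the torus**: `r_N(m, j) = Ξ_N(m-j)/Ξ_N(m) ≤ (1 - λ)^{-j}` for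
`j ≤ m ≤ N + 1`, assuming only `ε_N < 1/2` and `λ < 1` (the recursion `r_N(m, j+1) = r_N(m, j) q_N(m-1-j)` and the
one-step bound `qN_le_of_hsDiameter_lt_half`). -/
theorem rN_le_of_hsDiameter_lt_half {P : DensityProfile} {σ : ℝ} (hσ : 0 ≤ σ) {N : ℕ}
    (hε : hsDiameter σ N < 1 / 2) (hlam : ovDensity P σ < 1) {m j : ℕ} (hm : m ≤ N + 1) (hj : j ≤ m) :
    rN P σ N m j ≤ (1 - ovDensity P σ)⁻¹ ^ j := by
  have hpos : ∀ k, k ≤ N + 1 → 0 < XiN P σ N k := fun k hk => XiN_pos_of_hsDiameter_lt_half hσ hε hlam hk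
  induction j with
  | zero => rw [rN, Nat.sub_zero, div_self (hpos m hm).ne', pow_zero]
  | succ j ih =>
    have h1 : m - 1 - j + 1 = m - j := by omega
    have h2 : m - (j + 1) = m - 1 - j := by omega
    have hrec : rN P σ N m (j + 1) = rN P σ N m j * qN P σ N (m - 1 - j) := by
      rw [rN, rN, qN, h1, h2, div_mul_div_comm, mul_comm (XiN P σ N (m - j)),
        mul_div_mul_right _ _ (hpos _ (by omega)).ne']
    rw [hrec, pow_succ]
    exact mul_le_mul (ih (by omega)) (qN_le_of_hsDiameter_lt_half hσ hε hlam (by omega))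
      (div_nonneg (Xi_nonneg _) (Xi_nonneg _)) (pow_nonneg (inv_nonneg.2 (by linarith)) _)

/-- **The insertion bound of the uniform gas at every reduced density `0 < σ ≤ 1/2`**:
`Ξ_N(N+1-j)/Ξ_N(N+1) ≤ (1 - v₁σ³)^{-j}` for `j ≤ N + 1` — for `N ≥ 1` the diameter `ε_N` is below half the torus
and `v₁σ³ ≤ 11/20 < 1`; for `N = 0` (one particle) every hard-core probability equals `1`. -/
theorem rN_uniform_le_of_le_half {σ : ℝ} (hσ : 0 < σ) (hσ2 : σ ≤ 1 / 2) {N j : ℕ} (hj : j ≤ N + 1) :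
    rN uniformProfile σ N (N + 1) j ≤ (1 - v₁ * σ ^ 3)⁻¹ ^ j := by
  have hlam : v₁ * σ ^ 3 < 1 := (v₁_mul_cube_le hσ.le hσ2).trans_lt (by norm_num)
  rcases Nat.eq_zero_or_pos N with rfl | hN
  · have hXi : ∀ k, XiN uniformProfile σ 0 k = 1 := by
      intro k
      rw [XiN, Xi, hcProb]
      have huniv : hardCoreSet (Ov (hsDiameter σ 0)) (firstLabels (0 + 1) k) =
          (Set.univ : Set (Fin (0 + 1) → T3)) :=
        Set.eq_univ_of_forall fun x i _ j _ hij => (hij (Fin.ext (by have := i.2; have := j.2; omega))).elim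
      rw [huniv, probReal_univ]
    rw [rN, hXi, hXi, div_one]
    exact one_le_pow₀ ((one_le_inv₀ (by linarith)).2
      (by linarith [mul_nonneg v₁_pos.le (pow_nonneg hσ.le 3)]))
  · have h := rN_le_of_hsDiameter_lt_half (P := uniformProfile) hσ.le (hsDiameter_lt_half_of_one_le hσ2 hN)
      (by rwa [ovDensity_uniformProfile]) le_rfl hj
    rwa [ovDensity_uniformProfile] at h

/-! ## Ruelle's bound in event form: the canonical law against the ideal gas -/

/-- The IDEAL GAS on `(N+1)`-particle phase space is the zip of independent uniform positions and Maxwellian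
velocities: `(Haar ⊗ N(u₀, θ))^{⊗(N+1)}(E) = (Haar^{⊗(N+1)} ⊗ N(u₀,θ)^{⊗(N+1)})(zipConfig⁻¹ E)`. -/
theorem pi_prod_eq_prod_pi_preimage_zipConfig (u₀ : V3) (θ : ℝ) (N : ℕ) {E : Set (Config (N + 1) (Fin 3) T3)}
    (hE : MeasurableSet E) :
    Measure.pi (fun _ : Fin (N + 1) => (volume : Measure T3).prod (gaussMeasure u₀ θ)) E =
      ((Measure.pi fun _ : Fin (N + 1) => (volume : Measure T3)).prod
        (Measure.pi fun _ : Fin (N + 1) => gaussMeasure u₀ θ)) (zipConfig ⁻¹' E) := by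
  have hmp := (measurePreserving_arrowProdEquivProdArrow T3 V3 (Fin (N + 1)) (fun _ => (volume : Measure T3))
    (fun _ => gaussMeasure u₀ θ)).symm _
  exact (hmp.measure_preimage hE.nullMeasurableSet).symm

/-- **Ruelle's bound in event form.** For `0 < σ ≤ 1/2`, constant profiles `a, θ > 0`, `u₀`, a set of labels `S` and
a measurable event `E` of `(N+1)`-particle phase space involving only the labels in `S` (membership in `E` only
depends on `(zᵢ)_{i ∈ S}`): `localGibbsLaw(E) ≤ (1 - v₁σ³)^{-#S} · (Haar ⊗ N(u₀,θ))^{⊗(N+1)}(E)`. Proof: positions and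
velocities are independent under the canonical law (`localGibbsMeasure_rung0_eq_map`), the position factor being
`Ξ⁻¹ 𝟙[hard core] dq^{⊗(N+1)}`; slice by slice in the velocities drop the hard-core constraints involving `S`
(`pi_hardCore_inter_le_of_dependsOn`), which costs the ratio `Ξ(univ ∖ S)/Ξ(univ) = r_N(N+1, #S)`
(`hcProb_sdiff_mul_inv_eq_rN`), bounded by the insertion bound `rN_uniform_le_of_le_half`. -/
theorem localGibbsLaw_le_of_dependsOn {σ a θ : ℝ} (hσ : 0 < σ) (hσ2 : σ ≤ 1 / 2) (ha : 0 < a) (hθ : 0 < θ)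
    (u₀ : V3) (N : ℕ) (Φ : HardSphereFlow (Literature.Analysis.FluidPDE.Torus.geometry (Fin 3)) (hsDiameter σ N) (N + 1))
    (S : Finset (Fin (N + 1))) {E : Set (Config (N + 1) (Fin 3) T3)} (hE : MeasurableSet E)
    (hdep : ∀ z z' : Config (N + 1) (Fin 3) T3, (∀ i ∈ S, z i = z' i) → (z ∈ E ↔ z' ∈ E)) :
    localGibbsLaw σ (fun _ => a) (fun _ => u₀) (fun _ => θ) N Φ E ≤
      ENNReal.ofReal ((1 - v₁ * σ ^ 3)⁻¹ ^ S.card) *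
        Measure.pi (fun _ : Fin (N + 1) => (volume : Measure T3).prod (gaussMeasure u₀ θ)) E := by
  classical
  set Γ : Measure (Fin (N + 1) → V3) := Measure.pi fun _ => gaussMeasure u₀ θ with hΓ
  set Pq : Measure (Fin (N + 1) → T3) := Measure.pi fun _ => (volume : Measure T3) with hPq
  set HC : Set (Fin (N + 1) → T3) := hardCoreSet (Ov (hsDiameter σ N)) (Finset.univ : Finset (Fin (N + 1))) with hHC
  set Z : ℝ := hcProb (Ov (hsDiameter σ N)) (volume : Measure T3) (Finset.univ : Finset (Fin (N + 1))) with hZ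
  set Ξ' : ℝ := hcProb (Ov (hsDiameter σ N)) (volume : Measure T3) ((Finset.univ : Finset (Fin (N + 1))) \ S) with hΞ'
  have hlaw : localGibbsLaw σ (fun _ => a) (fun _ => u₀) (fun _ => θ) N Φ =
      ((ENNReal.ofReal Z⁻¹ • Pq.restrict HC).prod Γ).map zipConfig := by
    rw [localGibbsLaw_eq, localGibbsMeasure_rung0_eq_map σ ha.le hθ u₀ N, posGibbsMeasure_const_eq_one ha,
      posGibbsMeasure_eq continuous_const (fun _ => one_pos), Xi, firstLabels_self, profileOf_one_μ]
  have hzE : MeasurableSet (zipConfig ⁻¹' E) := measurable_zipConfig hE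
  have hslice : ∀ v : Fin (N + 1) → V3, MeasurableSet {q : Fin (N + 1) → T3 | zipConfig (q, v) ∈ E} := fun v =>
    (measurable_zipConfig.comp (measurable_id.prodMk measurable_const)) hE
  have hdep' : ∀ (v : Fin (N + 1) → V3) (q q' : Fin (N + 1) → T3), (∀ b ∈ S, q b = q' b) →
      (q ∈ {q : Fin (N + 1) → T3 | zipConfig (q, v) ∈ E} ↔ q' ∈ {q : Fin (N + 1) → T3 | zipConfig (q, v) ∈ E}) := by
    intro v q q' hqq'
    refine hdep _ _ fun i hi => ?_
    show (q i, v i) = (q' i, v i)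
    rw [hqq' i hi]
  have hbound : ∀ v : Fin (N + 1) → V3,
      (ENNReal.ofReal Z⁻¹ • Pq.restrict HC) ((fun q => (q, v)) ⁻¹' (zipConfig ⁻¹' E)) ≤
        ENNReal.ofReal Z⁻¹ * ENNReal.ofReal Ξ' * Pq {q | zipConfig (q, v) ∈ E} := by
    intro v
    change (ENNReal.ofReal Z⁻¹ • Pq.restrict HC) {q | zipConfig (q, v) ∈ E} ≤ _
    rw [Measure.smul_apply, smul_eq_mul, Measure.restrict_apply (hslice v), Set.inter_comm, mul_assoc]
    exact mul_le_mul' le_rfl (pi_hardCore_inter_le_of_dependsOn (hsDiameter σ N) S (hslice v) (hdep' v))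
  have hne : ENNReal.ofReal Z⁻¹ * ENNReal.ofReal Ξ' ≠ ⊤ := ENNReal.mul_ne_top ENNReal.ofReal_ne_top ENNReal.ofReal_ne_top
  rw [hlaw, Measure.map_apply measurable_zipConfig hE, Measure.prod_apply_symm hzE]
  calc ∫⁻ v, (ENNReal.ofReal Z⁻¹ • Pq.restrict HC) ((fun q => (q, v)) ⁻¹' (zipConfig ⁻¹' E)) ∂Γ
      ≤ ∫⁻ v, ENNReal.ofReal Z⁻¹ * ENNReal.ofReal Ξ' * Pq {q | zipConfig (q, v) ∈ E} ∂Γ := lintegral_mono hbound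
    _ = ENNReal.ofReal Z⁻¹ * ENNReal.ofReal Ξ' * ∫⁻ v, Pq {q | zipConfig (q, v) ∈ E} ∂Γ :=
        lintegral_const_mul' _ _ hne
    _ = ENNReal.ofReal Z⁻¹ * ENNReal.ofReal Ξ' * (Pq.prod Γ) (zipConfig ⁻¹' E) := by
        rw [Measure.prod_apply_symm hzE]
        rfl
    _ = ENNReal.ofReal (rN uniformProfile σ N (N + 1) S.card) *
          Measure.pi (fun _ : Fin (N + 1) => (volume : Measure T3).prod (gaussMeasure u₀ θ)) E := by
        rw [pi_prod_eq_prod_pi_preimage_zipConfig u₀ θ N hE, ← hcProb_sdiff_mul_inv_eq_rN σ S,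
          ENNReal.ofReal_mul (hcProb_nonneg _ _), mul_comm (ENNReal.ofReal Ξ')]
    _ ≤ _ := mul_le_mul' (ENNReal.ofReal_le_ofReal (rN_uniform_le_of_le_half hσ hσ2
      (by simpa using S.card_le_univ))) le_rfl

/-! ## Products of dominated measures -/

/-- **Powers of dominated measures**: `κ ≤ c • ν` implies `κ^{⊗m} ≤ cᵐ • ν^{⊗m}` on `Fin m → Y` (induction on `m`
through `Fin (m+1) → Y ≃ Y × (Fin m → Y)`, `Measure.prod_mono`). -/
theorem pi_le_pow_smul_pi {Y : Type*} [MeasurableSpace Y] {κ ν : Measure Y} [SigmaFinite κ] [SigmaFinite ν]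
    {c : ℝ≥0∞} (h : κ ≤ c • ν) :
    ∀ m : ℕ, Measure.pi (fun _ : Fin m => κ) ≤ c ^ m • Measure.pi (fun _ : Fin m => ν)
  | 0 => by
      rw [Measure.pi_of_empty (fun _ : Fin 0 => κ), Measure.pi_of_empty (fun _ : Fin 0 => ν), pow_zero, one_smul]
  | m + 1 => by
      have ih := pi_le_pow_smul_pi h m
      have eκ := (measurePreserving_piFinSuccAbove (fun _ : Fin (m + 1) => κ) 0).symm _
      have eν := (measurePreserving_piFinSuccAbove (fun _ : Fin (m + 1) => ν) 0).symm _
      calc Measure.pi (fun _ : Fin (m + 1) => κ)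
          = Measure.map (MeasurableEquiv.piFinSuccAbove (fun _ : Fin (m + 1) => Y) 0).symm
              (κ.prod (Measure.pi fun _ : Fin m => κ)) := eκ.map_eq.symm
        _ ≤ Measure.map (MeasurableEquiv.piFinSuccAbove (fun _ : Fin (m + 1) => Y) 0).symm
              ((c • ν).prod (c ^ m • Measure.pi fun _ : Fin m => ν)) :=
            Measure.map_mono (Measure.prod_mono h ih) (MeasurableEquiv.measurable _)
        _ = c ^ (m + 1) • Measure.map (MeasurableEquiv.piFinSuccAbove (fun _ : Fin (m + 1) => Y) 0).symm
              (ν.prod (Measure.pi fun _ : Fin m => ν)) := by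
            rw [Measure.prod_smul_left, Measure.prod_smul_right, smul_smul, Measure.map_smul, pow_succ']
        _ = c ^ (m + 1) • Measure.pi (fun _ : Fin (m + 1) => ν) := by rw [eν.map_eq]

/-! ## The blow-up of ideal-gas particles -/

/-- The single-particle blow-up map is measurable. -/
theorem measurable_blowUpPoint (ε : ℝ) (x : T3) : Measurable (blowUpPoint ε x) :=
  ((measurable_const_smul ε⁻¹).comp (measurable_reprSym.comp (measurable_fst.sub measurable_const))).prodMk
    measurable_snd

/-- **Blown-up positions of a uniform particle**: the law of `ε⁻¹ reprSym(q - x)` for `q` Haar-distributed is at most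
`ε³ · Leb` (it is exactly `ε³ · Leb` restricted to the cube `ε⁻¹ (-1/2, 1/2]³`): translation invariance of Haar
measure, `map_reprSym_volume`, and the scaling of Lebesgue measure under `y ↦ ε⁻¹ y`. -/
theorem map_volume_blowUpPos_le {ε : ℝ} (hε : 0 < ε) (x : T3) :
    (volume : Measure T3).map (fun q => ε⁻¹ • reprSym (q - x)) ≤ ENNReal.ofReal (ε ^ 3) • (volume : Measure V3) := by
  have h1 : (fun q : T3 => ε⁻¹ • reprSym (q - x)) = (fun y : V3 => ε⁻¹ • y) ∘ reprSym ∘ fun q : T3 => q - x := rfl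
  rw [h1, ← Measure.map_map (measurable_const_smul ε⁻¹) (measurable_reprSym.comp (measurable_sub_const x)),
    ← Measure.map_map measurable_reprSym (measurable_sub_const x), (measurePreserving_sub_right volume x).map_eq,
    map_reprSym_volume]
  calc ((volume : Measure V3).restrict (symCube (Fin 3))).map (fun y : V3 => ε⁻¹ • y)
      ≤ (volume : Measure V3).map (fun y : V3 => ε⁻¹ • y) :=
        Measure.map_mono Measure.restrict_le_self (measurable_const_smul _)
    _ = ENNReal.ofReal (ε ^ 3) • volume := by
        rw [Measure.map_addHaar_smul volume (inv_ne_zero hε.ne'), finrank_euclideanSpace_fin, inv_pow, inv_inv,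
          abs_of_pos (pow_pos hε 3)]

/-- **Blow-up of one ideal-gas particle**: the law of `blowUpPoint ε x (q, v)` under `Haar ⊗ N(u₀, θ)` is at most
`ε³ · (Leb ⊗ N(u₀, θ))`, whatever the base point `x`. -/
theorem map_blowUpPoint_le {ε : ℝ} (hε : 0 < ε) (x : T3) (u₀ : V3) (θ : ℝ) :
    ((volume : Measure T3).prod (gaussMeasure u₀ θ)).map (blowUpPoint ε x) ≤
      ENNReal.ofReal (ε ^ 3) • ((volume : Measure V3).prod (gaussMeasure u₀ θ)) := by
  have h1 : blowUpPoint ε x = Prod.map (fun q : T3 => ε⁻¹ • reprSym (q - x)) id := by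
    funext p
    rfl
  have hg : Measurable fun q : T3 => ε⁻¹ • reprSym (q - x) :=
    (measurable_const_smul ε⁻¹).comp (measurable_reprSym.comp (measurable_sub_const x))
  rw [h1, ← Measure.map_prod_map _ _ hg measurable_id, Measure.map_id, ← Measure.prod_smul_left]
  exact Measure.prod_mono (map_volume_blowUpPos_le hε x) le_rfl

/-- **Blow-ups of distinct labelled ideal-gas particles.** Under the ideal gas `(Haar ⊗ N(u₀,θ))^{⊗n}` and for an
injective labelling `ℓ : Fin m → Fin n`, the joint law of `(blowUpPoint ε x (z (ℓ j)))_j` is at most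
`(ε³)ᵐ · (Leb ⊗ N(u₀,θ))^{⊗m}`: distinct labels are independent (`iIndepFun_pi`, `iIndepFun.precomp`), so the joint
law is the product of the single-particle laws (`map_blowUpPoint_le`, `pi_le_pow_smul_pi`). -/
theorem pi_blowUpLabels_le {ε : ℝ} (hε : 0 < ε) (x : T3) (u₀ : V3) (θ : ℝ) {n m : ℕ} {ℓ : Fin m → Fin n}
    (hℓ : Injective ℓ) {F : Set (Fin m → V3 × V3)} (hF : MeasurableSet F) :
    Measure.pi (fun _ : Fin n => (volume : Measure T3).prod (gaussMeasure u₀ θ))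
        {z | (fun j => blowUpPoint ε x (z (ℓ j))) ∈ F} ≤
      ENNReal.ofReal (ε ^ 3) ^ m * Measure.pi (fun _ : Fin m => (volume : Measure V3).prod (gaussMeasure u₀ θ)) F := by
  haveI : IsProbabilityMeasure (volume : Measure T3) := by rw [volume_pi]; infer_instance
  set ν : Measure (T3 × V3) := (volume : Measure T3).prod (gaussMeasure u₀ θ) with hν
  have hb : Measurable (blowUpPoint ε x) := measurable_blowUpPoint ε x
  have hind : ProbabilityTheory.iIndepFun (fun (j : Fin m) (z : Fin n → T3 × V3) => blowUpPoint ε x (z (ℓ j)))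
      (Measure.pi fun _ : Fin n => ν) :=
    (ProbabilityTheory.iIndepFun_pi (μ := fun _ : Fin n => ν) (X := fun _ => blowUpPoint ε x)
      fun _ => hb.aemeasurable).precomp hℓ
  have hbj : ∀ j : Fin m, Measurable fun z : Fin n → T3 × V3 => blowUpPoint ε x (z (ℓ j)) := fun j =>
    hb.comp (measurable_pi_apply (ℓ j))
  have hmap : (Measure.pi fun _ : Fin n => ν).map (fun (z : Fin n → T3 × V3) (j : Fin m) => blowUpPoint ε x (z (ℓ j))) =
      Measure.pi fun j : Fin m => (Measure.pi fun _ : Fin n => ν).map fun z => blowUpPoint ε x (z (ℓ j)) :=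
    hind.map_fun_eq_pi_map fun j => (hbj j).aemeasurable
  have hmarg : ∀ j : Fin m, (Measure.pi fun _ : Fin n => ν).map (fun z => blowUpPoint ε x (z (ℓ j))) =
      ν.map (blowUpPoint ε x) := by
    intro j
    calc (Measure.pi fun _ : Fin n => ν).map (fun z => blowUpPoint ε x (z (ℓ j)))
        = ((Measure.pi fun _ : Fin n => ν).map (Function.eval (ℓ j))).map (blowUpPoint ε x) :=
          (Measure.map_map hb (measurable_pi_apply (ℓ j))).symm
      _ = ν.map (blowUpPoint ε x) := by rw [(measurePreserving_eval (fun _ : Fin n => ν) (ℓ j)).map_eq]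
  have hmeas : Measurable fun (z : Fin n → T3 × V3) (j : Fin m) => blowUpPoint ε x (z (ℓ j)) :=
    measurable_pi_lambda _ fun j => hb.comp (measurable_pi_apply (ℓ j))
  rw [show {z : Fin n → T3 × V3 | (fun j => blowUpPoint ε x (z (ℓ j))) ∈ F} =
      (fun (z : Fin n → T3 × V3) (j : Fin m) => blowUpPoint ε x (z (ℓ j))) ⁻¹' F from rfl,
    ← Measure.map_apply hmeas hF, hmap]
  simp_rw [hmarg]
  calc Measure.pi (fun _ : Fin m => ν.map (blowUpPoint ε x)) F
      ≤ (ENNReal.ofReal (ε ^ 3) ^ m • Measure.pi (fun _ : Fin m => (volume : Measure V3).prod (gaussMeasure u₀ θ))) F :=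
        Measure.le_iff'.1 (pi_le_pow_smul_pi (map_blowUpPoint_le hε x u₀ θ) m) F
    _ = _ := by rw [Measure.smul_apply, smul_eq_mul]

/-! ## The joint law of the blow-ups of distinct labels under the canonical law -/

/-- **Blow-ups of distinct labelled particles under the canonical law.** For `0 < σ ≤ 1/2`, `a, θ > 0`, `u₀`, any
base point `x ∈ 𝕋³`, an injective labelling `ℓ : Fin m → Fin (N+1)` and a measurable `F ⊆ (ℝ³ × ℝ³)^m`:
`localGibbsLaw {z | (blowUpPoint ε_N x (z (ℓ j)))_j ∈ F} ≤ ((1 - v₁σ³)⁻¹ ε_N³)ᵐ · (Leb ⊗ N(u₀,θ))^{⊗m}(F)`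
(Ruelle's bound `localGibbsLaw_le_of_dependsOn` for the labels `ℓ(Fin m)`, then the ideal-gas computation
`pi_blowUpLabels_le`). -/
theorem localGibbsLaw_blowUpLabels_le {σ a θ : ℝ} (hσ : 0 < σ) (hσ2 : σ ≤ 1 / 2) (ha : 0 < a) (hθ : 0 < θ) (u₀ : V3) (x : T3) (N : ℕ) (Φ : HardSphereFlow (Literature.Analysis.FluidPDE.Torus.geometry (Fin 3)) (hsDiameter σ N) (N + 1)) {m : ℕ} {ℓ : Fin m → Fin (N + 1)} (hℓ : Injective ℓ) {F : Set (Fin m → V3 × V3)} (hF : MeasurableSet F) : localGibbsLaw σ (fun _ => a) (fun _ => u₀) (fun _ => θ) N Φ {z | (fun j => blowUpPoint (hsDiameter σ N) x (z (ℓ j))) ∈ F} ≤ ENNReal.ofReal (((1 - v₁ * σ ^ 3)⁻¹ * hsDiameter σ N ^ 3) ^ m) * Measure.pi (fun _ : Fin m => (volume : Measure V3).prod (gaussMeasure u₀ θ)) F := by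
  classical
  have hb : Measurable (blowUpPoint (hsDiameter σ N) x) := measurable_blowUpPoint _ x
  have hmeas : Measurable fun (z : Config (N + 1) (Fin 3) T3) (j : Fin m) => blowUpPoint (hsDiameter σ N) x (z (ℓ j)) :=
    measurable_pi_lambda _ fun j => hb.comp (measurable_pi_apply (ℓ j))
  have hE : MeasurableSet {z : Config (N + 1) (Fin 3) T3 | (fun j => blowUpPoint (hsDiameter σ N) x (z (ℓ j))) ∈ F} :=
    hmeas hF
  have hdep : ∀ z z' : Config (N + 1) (Fin 3) T3, (∀ i ∈ Finset.univ.image ℓ, z i = z' i) →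
      (z ∈ {z : Config (N + 1) (Fin 3) T3 | (fun j => blowUpPoint (hsDiameter σ N) x (z (ℓ j))) ∈ F} ↔
        z' ∈ {z : Config (N + 1) (Fin 3) T3 | (fun j => blowUpPoint (hsDiameter σ N) x (z (ℓ j))) ∈ F}) := by
    intro z z' hzz'
    have hfun : (fun j => blowUpPoint (hsDiameter σ N) x (z (ℓ j))) =
        fun j => blowUpPoint (hsDiameter σ N) x (z' (ℓ j)) := by
      funext j
      rw [hzz' (ℓ j) (Finset.mem_image_of_mem ℓ (Finset.mem_univ j))]
    simp only [Set.mem_setOf_eq, hfun]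
  have hcard : (Finset.univ.image ℓ).card = m := by
    rw [Finset.card_image_of_injective _ hℓ, Finset.card_univ, Fintype.card_fin]
  have hc0 : 0 ≤ (1 - v₁ * σ ^ 3)⁻¹ := by
    have := v₁_mul_cube_le hσ.le hσ2
    exact inv_nonneg.2 (by linarith)
  calc localGibbsLaw σ (fun _ => a) (fun _ => u₀) (fun _ => θ) N Φ
        {z | (fun j => blowUpPoint (hsDiameter σ N) x (z (ℓ j))) ∈ F}
      ≤ ENNReal.ofReal ((1 - v₁ * σ ^ 3)⁻¹ ^ (Finset.univ.image ℓ).card) *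
          Measure.pi (fun _ : Fin (N + 1) => (volume : Measure T3).prod (gaussMeasure u₀ θ))
            {z | (fun j => blowUpPoint (hsDiameter σ N) x (z (ℓ j))) ∈ F} :=
        localGibbsLaw_le_of_dependsOn hσ hσ2 ha hθ u₀ N Φ _ hE hdep
    _ ≤ ENNReal.ofReal ((1 - v₁ * σ ^ 3)⁻¹ ^ m) * (ENNReal.ofReal (hsDiameter σ N ^ 3) ^ m *
          Measure.pi (fun _ : Fin m => (volume : Measure V3).prod (gaussMeasure u₀ θ)) F) := by
        rw [hcard]
        exact mul_le_mul' le_rfl (pi_blowUpLabels_le (hsDiameter_pos hσ N) x u₀ θ hℓ hF)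
    _ = _ := by
        rw [← mul_assoc, ← ENNReal.ofReal_pow (pow_nonneg (hsDiameter_pos hσ N).le 3), ← ENNReal.ofReal_mul
          (pow_nonneg hc0 _), ← mul_pow]

end Summit.AtomisticToContinuum.HydrodynamicLimit.Theorems.KiferCompactification

end
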